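import Literature.NumberTheory.DiophantineGeometry.TensorWordModel
import Mathlib.LinearAlgebra.Matrix.Kronecker
import HarnessLib

/-!
# Kronecker products `a ⊗ b ∈ GL_{m²}`, the stabilizer of `det_m`, and their invariants on
# `(k^{m²})^{⊗D}`
(trunk ArithGeomL / CplxAlg; infrastructure for the Kronecker bound
`orbitMultiplicity_det_le_kroneckerCoeff` of `SchurWeylPlethysm`)

Write `W = E ⊗ F`, `E = F = k^m`, so that `GL(E) × GL(F) → GL(W)`, `(a, b) ↦ a ⊗ b` (Kronecker
product). On the generic matrix `X = (X_{ij})` the linear substitution by `a ⊗ b` is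
`X ↦ aᵀ X b`, whence `(a ⊗ b) · det_m = det(a) det(b) det_m` (`linSubst_kronecker_detPoly`): the
pairs with `det a · det b = 1` stabilise the determinant (BLMW 2011 §5.2: "`GL(W)(det_n) =
S(GL(E) × GL(F)) ⋊ ℤ₂`", of which only the easy inclusion `⊇ S(GL(E) × GL(F))` is needed and
proved here). This file then analyses, in the coordinate model `wordRep k (m*m) D` of
`W^{⊗D}` (`TensorWordModel`, alphabet `Fin (m*m) ≃ Fin m × Fin m` via `finProdFinEquiv`):

* `kronFin a b ∈ GL_{m²}(k)` and its action: splitting a word in the alphabet `Fin m × Fin m`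
  into its two component words identifies `W^{⊗D}` with functions of pairs of words
  (`splitFun`), `𝔖_D`-equivariantly (`splitFun_wordPerm`), and `a ⊗ b` acts by `a^{⊗D}` on the
  first and `b^{⊗D}` on the second component (`splitFun_wordRep_kronFin`, i.e. `M ↦ a^{⊗D} M (b^{⊗D})ᵀ`);
* the space `kronInvariants` of vectors fixed by all `a ⊗ b` with `a, b` upper triangular of
  determinant `1` corresponds under the splitting to the functions of pairs of words all of whose
  slices lie in `unimodularBorelInvariants` = the vectors of `E^{⊗D}` fixed by the upper
  triangular matrices of determinant `1` (`mem_kronInvariants_iff_slices`).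

The identification of `unimodularBorelInvariants` with the highest-weight space of the
rectangular weight `(d, …, d)` (`D = m d`) and the resulting character formula are in
`SchurWeylPlethysmKroneckerBoundProofs` (§0 there).

## Sources

* P. Bürgisser, J. M. Landsberg, L. Manivel, J. Weyman, *An overview of mathematical issues
  arising in the geometric complexity theory approach to VP ≠ VNP*, SIAM J. Comput. 40 (2011),
  §5.2 (stabilizer of `det_n`, `W = E ⊗ F`). [cite: BLMW2011, §5.2]
* G. Frobenius, *Über die Darstellung der endlichen Gruppen durch lineare Substitutionen*,
  Sitzungsber. Preuss. Akad. (1897) (the stabilizer of the determinant). [folklore]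
* W. Fulton, J. Harris, *Representation Theory. A First Course*, GTM 129 (1991), Ex. 6.11
  (`Sym^d(V ⊗ W)` and Kronecker coefficients), §15.3. [folklore]

## Mathlib and tree

Used: `Matrix.kroneckerMap` (`kroneckerMap_apply`, `mul_kronecker_mul`, `one_kronecker_one`),
`Matrix.reindex`/`submatrix` (`submatrix_mul_equiv`, `submatrix_one_equiv`), `finProdFinEquiv`,
`Matrix.GeneralLinearGroup`, `AlgHom.map_det`/`RingHom.map_det`, `Matrix.det_mul`,
`Matrix.det_transpose`, `Matrix.mvPolynomialX`; from the tree `detPoly` (`StandardFamilies`),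
`linSubst` (`linSubst_X`, `LinSubst`), `wordRep`, `wordRep_apply`, `wordPerm`, `wordPerm_apply`
(`TensorWordModel`). Mathlib has no Kronecker-product subgroup of `GL_{mn}` acting on tensor
powers.

## Design

`namespace Literature.CplxAlg`; `k` a field. `kronFin a b` is the unit of `Matrix (Fin (m*m)) (Fin (m*m)) k`
with matrix `reindex e e (a ⊗ₖ b)`, `e = finProdFinEquiv`, and inverse `reindex e e (a⁻¹ ⊗ₖ b⁻¹)`.
Functions of pairs of words are uncurried (`Word m D × Word m D → k`) to match
`sliceSubmodule` of `SliceRepresentation`; the `𝔖_D`- and `GL × GL`-actions on them are written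
out by explicit formulas (`pairPermAct`, and the Kronecker-power sums), and identified with the
transported tensor product representations only downstream.
-/

noncomputable section

open scoped BigOperators Matrix Kronecker
open MvPolynomial

namespace Literature.NumberTheory.DiophantineGeometry

variable (k : Type*) [Field k] (m : ℕ)

/-! ### The Kronecker product as an element of `GL_{m²}` -/

/-- The Kronecker product `a ⊗ b` of two `m × m` matrices as an `m² × m²` matrix indexed by
`Fin (m*m)` (rows and columns enumerated by `finProdFinEquiv`, `(i, j) ↦ m i + j`):
entry `(e (i,j), e (i',j')) = a i i' * b j j'`. BLMW 2011 §5.2 (`GL(E) × GL(F) ⊂ GL(E ⊗ F)`).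
[folklore] -/
def kronFinMat (a b : Matrix (Fin m) (Fin m) k) : Matrix (Fin (m * m)) (Fin (m * m)) k :=
  Matrix.reindex finProdFinEquiv finProdFinEquiv (a ⊗ₖ b)

/-- Entries of `kronFinMat`: `(n, n') ↦ a (n/m) (n'/m) * b (n%m) (n'%m)`. [folklore] -/
theorem kronFinMat_apply (a b : Matrix (Fin m) (Fin m) k) (n n' : Fin (m * m)) :
    kronFinMat k m a b n n' =
      a (finProdFinEquiv.symm n).1 (finProdFinEquiv.symm n').1 *
        b (finProdFinEquiv.symm n).2 (finProdFinEquiv.symm n').2 :=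
  rfl

/-- Entries of `kronFinMat` at enumerated pairs: `(e (i,j), e (i',j')) ↦ a i i' * b j j'`.
[folklore] -/
@[simp]
theorem kronFinMat_apply_finProdFinEquiv (a b : Matrix (Fin m) (Fin m) k) (p q : Fin m × Fin m) :
    kronFinMat k m a b (finProdFinEquiv p) (finProdFinEquiv q) = a p.1 q.1 * b p.2 q.2 := by
  rw [kronFinMat_apply, Equiv.symm_apply_apply, Equiv.symm_apply_apply]

/-- `kronFinMat` is multiplicative in the pair `(a, b)`. [folklore] -/
theorem kronFinMat_mul (a b a' b' : Matrix (Fin m) (Fin m) k) :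
    kronFinMat k m (a * a') (b * b') = kronFinMat k m a b * kronFinMat k m a' b' := by
  unfold kronFinMat
  rw [Matrix.mul_kronecker_mul, Matrix.reindex_apply, Matrix.reindex_apply, Matrix.reindex_apply,
    Matrix.submatrix_mul_equiv]

/-- `kronFinMat 1 1 = 1`. [folklore] -/
theorem kronFinMat_one : kronFinMat k m 1 1 = 1 := by
  unfold kronFinMat
  rw [Matrix.one_kronecker_one, Matrix.reindex_apply, Matrix.submatrix_one_equiv]

/-- The Kronecker product `a ⊗ b ∈ GL_{m²}(k)` of two invertible `m × m` matrices (the image of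
`GL(E) × GL(F) → GL(E ⊗ F)`). BLMW 2011 §5.2. [cite: BLMW2011, §5.2] -/
def kronFin (a b : GL (Fin m) k) : GL (Fin (m * m)) k where
  val := kronFinMat k m a b
  inv := kronFinMat k m ((a⁻¹ : GL (Fin m) k) : Matrix (Fin m) (Fin m) k)
    ((b⁻¹ : GL (Fin m) k) : Matrix (Fin m) (Fin m) k)
  val_inv := by
    rw [← kronFinMat_mul, ← Units.val_mul, ← Units.val_mul, mul_inv_cancel, mul_inv_cancel,
      Units.val_one, kronFinMat_one]
  inv_val := by
    rw [← kronFinMat_mul, ← Units.val_mul, ← Units.val_mul, inv_mul_cancel, inv_mul_cancel,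
      Units.val_one, kronFinMat_one]

/-- The matrix of `kronFin a b` (unfolding lemma). [folklore] -/
@[simp]
theorem coe_kronFin (a b : GL (Fin m) k) :
    ((kronFin k m a b : GL (Fin (m * m)) k) : Matrix (Fin (m * m)) (Fin (m * m)) k) =
      kronFinMat k m a b :=
  rfl

/-- `(a, b) ↦ a ⊗ b` is multiplicative. [folklore] -/
theorem kronFin_mul (a b a' b' : GL (Fin m) k) :
    kronFin k m (a * a') (b * b') = kronFin k m a b * kronFin k m a' b' :=
  Units.ext (by simp [kronFinMat_mul])

/-- `1 ⊗ 1 = 1`. [folklore] -/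
theorem kronFin_one : kronFin k m 1 1 = 1 :=
  Units.ext (by simp [kronFinMat_one])

/-! ### The stabilizer of the determinant -/

/-- **`(a ⊗ b) · det_m = det(a) det(b) det_m`.** The linear substitution by the Kronecker product
`a ⊗ₖ b` (matrix indexed by `Fin m × Fin m`) sends `X_{(i,j)} ↦ ∑ a_{i'i} b_{j'j} X_{(i',j')}`, i.e.
the generic matrix `X` to `aᵀ X b`, whose determinant is `det(a) det(X) det(b)`. In particular
`a ⊗ b` stabilises `det_m` when `det a · det b = 1` (BLMW 2011 §5.2: the stabilizer of `det_n` is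
`S(GL(E) × GL(F)) ⋊ ℤ₂`; Frobenius 1897). [cite: BLMW2011, §5.2] -/
theorem linSubst_kronecker_detPoly (a b : Matrix (Fin m) (Fin m) k) :
    Literature.Computability.AlgebraicComplexity.linSubst (Fin m × Fin m) k (a ⊗ₖ b) (Literature.Computability.AlgebraicComplexity.detPoly (Fin m) k) = (a.det * b.det) • Literature.Computability.AlgebraicComplexity.detPoly (Fin m) k := by
  unfold Literature.Computability.AlgebraicComplexity.detPoly
  rw [AlgHom.map_det]
  have hmat : (Literature.Computability.AlgebraicComplexity.linSubst (Fin m × Fin m) k (a ⊗ₖ b)).mapMatrix (Matrix.mvPolynomialX (Fin m) (Fin m) k) =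
      (aᵀ).map (C : k →+* MvPolynomial (Fin m × Fin m) k) * Matrix.mvPolynomialX (Fin m) (Fin m) k *
        b.map (C : k →+* MvPolynomial (Fin m × Fin m) k) := by
    refine Matrix.ext fun i j => ?_
    rw [AlgHom.mapMatrix_apply, Matrix.map_apply, Matrix.mvPolynomialX_apply, Literature.Computability.AlgebraicComplexity.linSubst_X]
    simp only [Matrix.mul_apply, Matrix.map_apply, Matrix.transpose_apply,
      Matrix.mvPolynomialX_apply, Matrix.kroneckerMap_apply, Finset.sum_mul]
    rw [Fintype.sum_prod_type, Finset.sum_comm]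
    refine Finset.sum_congr rfl fun y _ => Finset.sum_congr rfl fun x _ => ?_
    rw [smul_eq_C_mul, map_mul]
    ring
  rw [hmat, Matrix.det_mul, Matrix.det_mul, Matrix.transpose_map, Matrix.det_transpose,
    ← RingHom.mapMatrix_apply, ← RingHom.mapMatrix_apply, ← RingHom.map_det, ← RingHom.map_det,
    smul_eq_C_mul, map_mul]
  ring

/-! ### Splitting words in the alphabet `Fin m × Fin m` -/

variable (D : ℕ)

/-- Splitting a word in the alphabet `Fin (m*m) ≃ Fin m × Fin m` into its two component words.
[folklore] -/
def splitWord : Word (m * m) D ≃ Word m D × Word m D where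
  toFun w := (fun p => (finProdFinEquiv.symm (w p)).1, fun p => (finProdFinEquiv.symm (w p)).2)
  invFun uv := fun p => finProdFinEquiv (uv.1 p, uv.2 p)
  left_inv w := by
    funext p
    exact finProdFinEquiv.apply_symm_apply (w p)
  right_inv uv := by
    obtain ⟨u, v⟩ := uv
    simp

/-- Merging two component words (the inverse of `splitWord`, unfolding lemma). [folklore] -/
@[simp]
theorem splitWord_symm_apply (uv : Word m D × Word m D) (p : Fin D) :
    (splitWord m D).symm uv p = finProdFinEquiv (uv.1 p, uv.2 p) :=
  rfl

/-- Merging commutes with permutations of the positions. [folklore] -/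
theorem splitWord_symm_comp (u v : Word m D) (τ : Equiv.Perm (Fin D)) :
    (splitWord m D).symm (u, v) ∘ ⇑τ = (splitWord m D).symm (u ∘ ⇑τ, v ∘ ⇑τ) :=
  rfl

/-- **`W^{⊗D} ≃ (functions of pairs of words)`**: the linear isomorphism
`x ↦ ((u, v) ↦ x (merge u v))` induced by splitting words in the alphabet `Fin m × Fin m`
(`E ⊗ F`-words are pairs of an `E`-word and an `F`-word). Fulton–Harris Ex. 6.11. [folklore] -/
def splitFun : (Word (m * m) D → k) ≃ₗ[k] (Word m D × Word m D → k) :=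
  LinearEquiv.funCongrLeft k k (splitWord m D).symm

/-- Unfolding lemma for `splitFun`. [folklore] -/
@[simp]
theorem splitFun_apply (x : Word (m * m) D → k) (uv : Word m D × Word m D) :
    splitFun k m D x uv = x ((splitWord m D).symm uv) :=
  rfl

variable {m D}

/-- The simultaneous permutation of the positions of a pair of words, on functions of pairs:
`(pairPermAct τ M)(u, v) = M (u ∘ τ, v ∘ τ)`. [folklore] -/
def pairPermAct (τ : Equiv.Perm (Fin D)) (M : Word m D × Word m D → k) : Word m D × Word m D → k :=
  fun uv => M (uv.1 ∘ ⇑τ, uv.2 ∘ ⇑τ)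

omit [Field k] in
/-- Unfolding lemma for `pairPermAct`. [folklore] -/
@[simp]
theorem pairPermAct_apply (τ : Equiv.Perm (Fin D)) (M : Word m D × Word m D → k)
    (uv : Word m D × Word m D) : pairPermAct k τ M uv = M (uv.1 ∘ ⇑τ, uv.2 ∘ ⇑τ) :=
  rfl

/-- **`𝔖_D`-equivariance of the splitting**: `splitFun (τ · x) = pairPermAct τ (splitFun x)`.
[folklore] -/
theorem splitFun_wordPerm (τ : Equiv.Perm (Fin D)) (x : Word (m * m) D → k) :
    splitFun k m D (wordPerm k τ x) = pairPermAct k τ (splitFun k m D x) := by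
  funext uv
  obtain ⟨u, v⟩ := uv
  rw [splitFun_apply, wordPerm_apply, pairPermAct_apply, splitFun_apply, splitWord_symm_comp]

/-- Kronecker powers of a Kronecker product factor over the two component words:
`((a ⊗ b)^{⊗D})_{merge(u,v), merge(u',v')} = (a^{⊗D})_{u u'} (b^{⊗D})_{v v'}`. [folklore] -/
theorem prod_kronFinMat_splitWord_symm (a b : Matrix (Fin m) (Fin m) k) (u v u' v' : Word m D) :
    (∏ p, kronFinMat k m a b ((splitWord m D).symm (u, v) p) ((splitWord m D).symm (u', v') p)) =
      (∏ p, a (u p) (u' p)) * ∏ p, b (v p) (v' p) := by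
  rw [← Finset.prod_mul_distrib]
  refine Finset.prod_congr rfl fun p _ => ?_
  rw [splitWord_symm_apply, splitWord_symm_apply, kronFinMat_apply_finProdFinEquiv]

/-- **The action of `a ⊗ b` on functions of pairs of words**:
`splitFun ((a ⊗ b) · x)(u, v) = ∑_{u',v'} (a^{⊗D})_{u u'} (b^{⊗D})_{v v'} splitFun x (u', v')`,
i.e. `M ↦ a^{⊗D} M (b^{⊗D})ᵀ`. Fulton–Harris Ex. 6.11. [folklore] -/
theorem splitFun_wordRep_kronFin (a b : GL (Fin m) k) (x : Word (m * m) D → k) (u v : Word m D) :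
    splitFun k m D (wordRep k (m * m) D (kronFin k m a b) x) (u, v) =
      ∑ u' : Word m D, ∑ v' : Word m D,
        ((∏ p, (a : Matrix (Fin m) (Fin m) k) (u p) (u' p)) *
          ∏ p, (b : Matrix (Fin m) (Fin m) k) (v p) (v' p)) * splitFun k m D x (u', v') := by
  rw [splitFun_apply, wordRep_apply, ← Fintype.sum_prod_type']
  refine Fintype.sum_equiv (splitWord m D) _ _ fun w => ?_
  have hw : w = (splitWord m D).symm (splitWord m D w) := ((splitWord m D).symm_apply_apply w).symm
  conv_lhs => rw [hw]
  rw [coe_kronFin, prod_kronFinMat_splitWord_symm, splitFun_apply]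

/-- The first-factor action `M ↦ a^{⊗D} M` on functions of pairs of words. [folklore] -/
def leftKronAct (a : Matrix (Fin m) (Fin m) k) (M : Word m D × Word m D → k) :
    Word m D × Word m D → k :=
  fun uv => ∑ u' : Word m D, (∏ p, a (uv.1 p) (u' p)) * M (u', uv.2)

/-- The second-factor action `M ↦ M (b^{⊗D})ᵀ` on functions of pairs of words. [folklore] -/
def rightKronAct (b : Matrix (Fin m) (Fin m) k) (M : Word m D × Word m D → k) :
    Word m D × Word m D → k :=
  fun uv => ∑ v' : Word m D, (∏ p, b (uv.2 p) (v' p)) * M (uv.1, v')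

/-- Unfolding lemma: `leftKronAct a M (u, v) = (a^{⊗D} · M(·, v)) u` is the word-model action of
`a` on the column `u' ↦ M (u', v)`. [folklore] -/
theorem leftKronAct_apply (a : GL (Fin m) k) (M : Word m D × Word m D → k) (u v : Word m D) :
    leftKronAct k (a : Matrix (Fin m) (Fin m) k) M (u, v) =
      wordRep k m D a (fun u' => M (u', v)) u := by
  rw [leftKronAct, wordRep_apply]

/-- Unfolding lemma: `rightKronAct b M (u, v) = (b^{⊗D} · M(u, ·)) v` is the word-model action
of `b` on the row `v' ↦ M (u, v')`. [folklore] -/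
theorem rightKronAct_apply (b : GL (Fin m) k) (M : Word m D × Word m D → k) (u v : Word m D) :
    rightKronAct k (b : Matrix (Fin m) (Fin m) k) M (u, v) =
      wordRep k m D b (fun v' => M (u, v')) v := by
  rw [rightKronAct, wordRep_apply]

/-- `a ⊗ b` acts as the first-factor action of `a` after the second-factor action of `b`.
[folklore] -/
theorem splitFun_wordRep_kronFin_eq (a b : GL (Fin m) k) (x : Word (m * m) D → k) :
    splitFun k m D (wordRep k (m * m) D (kronFin k m a b) x) =
      leftKronAct k (a : Matrix (Fin m) (Fin m) k)
        (rightKronAct k (b : Matrix (Fin m) (Fin m) k) (splitFun k m D x)) := by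
  funext uv
  obtain ⟨u, v⟩ := uv
  rw [splitFun_wordRep_kronFin]
  simp only [leftKronAct, rightKronAct, Finset.mul_sum]
  refine Finset.sum_congr rfl fun u' _ => Finset.sum_congr rfl fun v' _ => ?_
  ring

/-- `a ⊗ 1` acts by the first-factor action of `a`. [folklore] -/
theorem splitFun_wordRep_kronFin_one_right (a : GL (Fin m) k) (x : Word (m * m) D → k) :
    splitFun k m D (wordRep k (m * m) D (kronFin k m a 1) x) =
      leftKronAct k (a : Matrix (Fin m) (Fin m) k) (splitFun k m D x) := by
  rw [splitFun_wordRep_kronFin_eq]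
  congr 1
  funext uv
  obtain ⟨u, v⟩ := uv
  rw [rightKronAct_apply, map_one, Module.End.one_apply]

/-- `1 ⊗ b` acts by the second-factor action of `b`. [folklore] -/
theorem splitFun_wordRep_kronFin_one_left (b : GL (Fin m) k) (x : Word (m * m) D → k) :
    splitFun k m D (wordRep k (m * m) D (kronFin k m 1 b) x) =
      rightKronAct k (b : Matrix (Fin m) (Fin m) k) (splitFun k m D x) := by
  rw [splitFun_wordRep_kronFin_eq]
  funext uv
  obtain ⟨u, v⟩ := uv
  rw [leftKronAct_apply, map_one, Module.End.one_apply]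

/-! ### Invariants of the unimodular Borel pairs -/

variable (m D)

/-- The vectors of `E^{⊗D}` (word model, `E = k^m`) fixed by every upper triangular matrix of
determinant `1` (the Borel subgroup of `SL_m`). They form the highest-weight space of the
rectangular weight `(d,…,d)` when `D = m d` (`SchurWeylPlethysmKroneckerBoundProofs`). BLMW 2011 §5.2
(`SL(E)`-invariants).
[folklore] -/
def unimodularBorelInvariants : Submodule k (Word m D → k) where
  carrier := {y | ∀ a : GL (Fin m) k, IsUpperTriangular a →
    (a : Matrix (Fin m) (Fin m) k).det = 1 → wordRep k m D a y = y}
  add_mem' {y y'} hy hy' a ha ha1 := by rw [map_add, hy a ha ha1, hy' a ha ha1]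
  zero_mem' a _ _ := by rw [map_zero]
  smul_mem' c {y} hy a ha ha1 := by rw [map_smul, hy a ha ha1]

/-- The vectors of `W^{⊗D}`, `W = E ⊗ F = k^{m²}` (word model), fixed by all Kronecker products
`a ⊗ b` of upper triangular matrices of determinant `1` — a subgroup of the stabilizer of `det_m`
(`linSubst_kronecker_detPoly`). BLMW 2011 §5.2. [cite: BLMW2011, §5.2] -/
def kronInvariants : Submodule k (Word (m * m) D → k) where
  carrier := {x | ∀ a b : GL (Fin m) k, IsUpperTriangular a → (a : Matrix (Fin m) (Fin m) k).det = 1 →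
    IsUpperTriangular b → (b : Matrix (Fin m) (Fin m) k).det = 1 →
      wordRep k (m * m) D (kronFin k m a b) x = x}
  add_mem' {x x'} hx hx' a b ha ha1 hb hb1 := by
    rw [map_add, hx a b ha ha1 hb hb1, hx' a b ha ha1 hb hb1]
  zero_mem' a b _ _ _ _ := by rw [map_zero]
  smul_mem' c {x} hx a b ha ha1 hb hb1 := by rw [map_smul, hx a b ha ha1 hb hb1]

variable {m D}

/-- Membership in `unimodularBorelInvariants` (unfolding lemma). [folklore] -/
theorem mem_unimodularBorelInvariants_iff (y : Word m D → k) :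
    y ∈ unimodularBorelInvariants k m D ↔ ∀ a : GL (Fin m) k, IsUpperTriangular a →
      (a : Matrix (Fin m) (Fin m) k).det = 1 → wordRep k m D a y = y :=
  Iff.rfl

/-- Membership in `kronInvariants` (unfolding lemma). [folklore] -/
theorem mem_kronInvariants_iff (x : Word (m * m) D → k) :
    x ∈ kronInvariants k m D ↔ ∀ a b : GL (Fin m) k, IsUpperTriangular a →
      (a : Matrix (Fin m) (Fin m) k).det = 1 → IsUpperTriangular b →
        (b : Matrix (Fin m) (Fin m) k).det = 1 → wordRep k (m * m) D (kronFin k m a b) x = x :=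
  Iff.rfl

/-- The identity matrix is upper triangular. [folklore] -/
theorem isUpperTriangular_one {n : ℕ} : IsUpperTriangular (1 : GL (Fin n) k) :=
  (borelSubgroup (Fin n) k).one_mem

/-- **Kronecker invariants are the functions of pairs of words with all slices invariant**: `x` is
fixed by all `a ⊗ b` (`a, b` upper triangular unimodular) iff every column `u ↦ splitFun x (u, v)`
and every row `v ↦ splitFun x (u, v)` lies in `unimodularBorelInvariants` (`a ⊗ b` acts by
`M ↦ a^{⊗D} M (b^{⊗D})ᵀ`; take `b = 1`, resp. `a = 1`). BLMW 2011 §5.2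
(`(S_π(E ⊗ F))^{SL(E)×SL(F)}` computed factorwise). [folklore] -/
theorem mem_kronInvariants_iff_slices (x : Word (m * m) D → k) :
    x ∈ kronInvariants k m D ↔
      (∀ v : Word m D, (fun u => splitFun k m D x (u, v)) ∈ unimodularBorelInvariants k m D) ∧
        ∀ u : Word m D, (fun v => splitFun k m D x (u, v)) ∈ unimodularBorelInvariants k m D := by
  constructor
  · intro hx
    refine ⟨fun v a ha ha1 => ?_, fun u b hb hb1 => ?_⟩
    · have h := congrArg (splitFun k m D) (hx a 1 ha ha1 (isUpperTriangular_one k) (by simp))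
      rw [splitFun_wordRep_kronFin_one_right] at h
      funext u
      have hu := congr_fun h (u, v)
      rwa [leftKronAct_apply] at hu
    · have h := congrArg (splitFun k m D) (hx 1 b (isUpperTriangular_one k) (by simp) hb hb1)
      rw [splitFun_wordRep_kronFin_one_left] at h
      funext v
      have hv := congr_fun h (u, v)
      rwa [rightKronAct_apply] at hv
  · rintro ⟨hcol, hrow⟩ a b ha ha1 hb hb1
    apply (splitFun k m D).injective
    rw [splitFun_wordRep_kronFin_eq]
    have hright : rightKronAct k (b : Matrix (Fin m) (Fin m) k) (splitFun k m D x) = splitFun k m D x := by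
      funext uv
      obtain ⟨u, v⟩ := uv
      rw [rightKronAct_apply, hrow u b hb hb1]
    rw [hright]
    funext uv
    obtain ⟨u, v⟩ := uv
    rw [leftKronAct_apply, hcol v a ha ha1]

end Literature.NumberTheory.DiophantineGeometry
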